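import Literature.MathematicalPhysics.KineticTheory.HardSphereEulerProofs
import Literature.Analysis.FunctionSpaces.TorusCalculusProofs
import Literature.Analysis.FunctionSpaces.TorusSpaceTime
import HarnessLib

/-!
# Assembly of route `OneSphereInfluence` (stmt-AtomisticToContinuum-14700): the one-particle score

Helper file for the assembly item `…Theses.OneSphereInfluence.Assembly`. Pointwise calculus of the
local Gibbs profile `f_κ(x, v) = a_κ(x) M_{1, u₀κ(x), θ₀κ(x)}(v)` along a jointly smooth path
`κ ∈ [0, 1] ↦ (a_κ, u₀κ, θ₀κ)` (`Torus.IsSmoothSpaceTimeOn (Icc 0 1)`, `κ` playing the role of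
time), `a_κ, θ₀κ > 0`: the closed form of `log f_κ` and of its one-sided `κ`-derivative within
`[0,1]` — the one-particle **score** `s_κ = ∂_κ log f_κ` — through the slice derivatives
`Torus.timeDerivWithin (Icc 0 1)`; `∂_κ f_κ = f_κ s_κ`; continuity in `(x, v)` and in `κ`; and
the compactness bounds `|s_κ(x,v)| ≤ A (1 + |v|²)`, `f_κ(x,v) ≤ B exp(-c|v|²)` (`c > 0`) uniformly
in `κ ∈ [0,1]`, `x ∈ 𝕋³`. These feed the finite-`N` score identity
`d/dκ E_{p_κ} F = Cov_{p_κ}(S_κ, F)`, `S_κ(z) = ∑ᵢ s_κ(zᵢ)`. Folklore calculus; no definitions.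
-/

noncomputable section

open MeasureTheory Filter Set Topology Real InnerProductSpace

namespace Summit.AtomisticToContinuum.HydrodynamicLimit.Theorems.OneSphereInfluenceAssembly

open Literature.Analysis.FunctionSpaces Literature.MathematicalPhysics.KineticTheory
open Literature.Analysis.FluidPDE (localMaxwellian)

/-! ## Compactness bounds for jointly smooth paths on `[0,1] × 𝕋³` -/

/-- A jointly smooth, pointwise positive scalar field on `[0,1] × 𝕋³` is bounded below by a
positive constant (continuity on the compact `[0,1] × [0,1]³`). [folklore] -/
theorem exists_pos_le_of_isSmoothSpaceTimeOn {f : ℝ → T3 → ℝ} (hf : Torus.IsSmoothSpaceTimeOn (Icc 0 1) f)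
    (h0 : ∀ κ ∈ Icc (0 : ℝ) 1, ∀ x, 0 < f κ x) :
    ∃ m : ℝ, 0 < m ∧ ∀ κ ∈ Icc (0 : ℝ) 1, ∀ x, m ≤ f κ x := by
  set cube : Set (EuclideanSpace ℝ (Fin 3)) :=
    (WithLp.toLp 2) '' (Set.pi univ fun _ : Fin 3 => Icc (0 : ℝ) 1) with hcube
  have hK : IsCompact (Icc (0 : ℝ) 1 ×ˢ cube) := isCompact_Icc.prod Torus.isCompact_toLp_image_pi_Icc
  have hne : (Icc (0 : ℝ) 1 ×ˢ cube).Nonempty :=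
    ⟨(0, Torus.repr (0 : T3)), mk_mem_prod ⟨le_rfl, zero_le_one⟩ (Torus.repr_mem_toLp_image_pi_Icc _)⟩
  have hcont : ContinuousOn (Torus.stLift f) (Icc (0 : ℝ) 1 ×ˢ cube) :=
    hf.continuousOn_stLift.mono (prod_mono subset_rfl (subset_univ _))
  obtain ⟨p, hpK, hpmin⟩ := hK.exists_isMinOn hne hcont
  refine ⟨Torus.stLift f p, ?_, fun κ hκ x => ?_⟩
  · rw [Torus.stLift_apply]
    exact h0 p.1 (mem_prod.1 hpK).1 _
  · have h := hpmin (mk_mem_prod hκ (Torus.repr_mem_toLp_image_pi_Icc x))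
    simpa using h

/-- A jointly smooth field on `[0,1] × 𝕋³` is bounded on `[0,1] × 𝕋³`, with a nonnegative bound.
[folklore] -/
theorem exists_norm_le_of_isSmoothSpaceTimeOn {F : Type*} [NormedAddCommGroup F] [NormedSpace ℝ F]
    {f : ℝ → T3 → F} (hf : Torus.IsSmoothSpaceTimeOn (Icc 0 1) f) :
    ∃ C : ℝ, 0 ≤ C ∧ ∀ κ ∈ Icc (0 : ℝ) 1, ∀ x, ‖f κ x‖ ≤ C := by
  obtain ⟨C, hC⟩ := hf.exists_norm_le_of_isCompact isCompact_Icc subset_rfl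
  exact ⟨max C 0, le_max_right _ _, fun κ hκ x => (hC κ hκ x).trans (le_max_left _ _)⟩

/-- The slice `κ`-derivative of a jointly smooth field on `[0,1] × 𝕋³` is bounded on
`[0,1] × 𝕋³`. [folklore] -/
theorem exists_norm_timeDerivWithin_le {F : Type*} [NormedAddCommGroup F] [NormedSpace ℝ F]
    {f : ℝ → T3 → F} (hf : Torus.IsSmoothSpaceTimeOn (Icc 0 1) f) :
    ∃ C : ℝ, 0 ≤ C ∧ ∀ κ ∈ Icc (0 : ℝ) 1, ∀ x, ‖Torus.timeDerivWithin (Icc 0 1) f κ x‖ ≤ C :=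
  exists_norm_le_of_isSmoothSpaceTimeOn (hf.timeDerivWithin (uniqueDiffOn_Icc zero_lt_one))

/-! ## The local Gibbs profile along a smooth path: logarithm and score -/

section Path

variable {a θ₀ : ℝ → T3 → ℝ} {u₀ : ℝ → T3 → V3}

/-- Closed form of the local Gibbs profile:
`f(x,v) = a(x) (2π θ₀(x))^{-3/2} exp(-|v - u₀(x)|²/(2θ₀(x)))`. [folklore] -/
theorem localGibbsProfile_eq (a₁ θ₁ : T3 → ℝ) (u₁ : T3 → V3) (y : T3 × V3) :
    localGibbsProfile a₁ u₁ θ₁ y =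
      a₁ y.1 * ((2 * π * θ₁ y.1) ^ (-(3 : ℝ) / 2) * Real.exp (-‖y.2 - u₁ y.1‖ ^ 2 / (2 * θ₁ y.1))) := by
  rw [localGibbsProfile, Literature.Analysis.FluidPDE.localMaxwellian, finrank_euclideanSpace,
    Fintype.card_fin, one_mul]
  norm_num

/-- The local Gibbs profile is positive when `a, θ₀ > 0`. [folklore] -/
theorem localGibbsProfile_pos' {a₁ θ₁ : T3 → ℝ} (u₁ : T3 → V3) {y : T3 × V3} (ha : 0 < a₁ y.1)
    (hθ : 0 < θ₁ y.1) : 0 < localGibbsProfile a₁ u₁ θ₁ y :=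
  mul_pos ha (localMaxwellian_pos zero_lt_one hθ _ _)

/-- **Logarithm of the local Gibbs profile**:
`log f(x,v) = log a(x) - (3/2) log(2π θ₀(x)) - |v - u₀(x)|² / (2θ₀(x))`. [folklore] -/
theorem log_localGibbsProfile {a₁ θ₁ : T3 → ℝ} (u₁ : T3 → V3) {y : T3 × V3} (ha : 0 < a₁ y.1)
    (hθ : 0 < θ₁ y.1) :
    Real.log (localGibbsProfile a₁ u₁ θ₁ y) =
      Real.log (a₁ y.1) - 3 / 2 * Real.log (2 * π * θ₁ y.1) - ‖y.2 - u₁ y.1‖ ^ 2 / (2 * θ₁ y.1) := by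
  have h2πθ : 0 < 2 * π * θ₁ y.1 := by positivity
  rw [localGibbsProfile_eq, Real.log_mul ha.ne' (mul_pos (Real.rpow_pos_of_pos h2πθ _) (Real.exp_pos _)).ne',
    Real.log_mul (Real.rpow_pos_of_pos h2πθ _).ne' (Real.exp_pos _).ne', Real.log_rpow h2πθ,
    Real.log_exp]
  ring

variable (ha : Torus.IsSmoothSpaceTimeOn (Icc 0 1) a) (hθ : Torus.IsSmoothSpaceTimeOn (Icc 0 1) θ₀)
  (hu : Torus.IsSmoothSpaceTimeOn (Icc 0 1) u₀)
  (ha0 : ∀ κ ∈ Icc (0 : ℝ) 1, ∀ x, 0 < a κ x) (hθ0 : ∀ κ ∈ Icc (0 : ℝ) 1, ∀ x, 0 < θ₀ κ x)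

include ha hθ hu ha0 hθ0 in
/-- **The one-particle score.** Along a jointly smooth path of profiles, `κ ↦ log f_κ(x,v)` has
the one-sided derivative within `[0,1]`
`s_κ(x,v) = ȧ/a - (3/2) θ̇/θ + ⟪v - u, u̇⟫/θ + θ̇ |v - u|² / (2θ²)`
(dots = slice `κ`-derivatives `Torus.timeDerivWithin (Icc 0 1)`). [folklore] -/
theorem hasDerivWithinAt_log_localGibbsProfile {κ : ℝ} (hκ : κ ∈ Icc (0 : ℝ) 1) (y : T3 × V3) :
    HasDerivWithinAt (fun κ' => Real.log (localGibbsProfile (a κ') (u₀ κ') (θ₀ κ') y))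
      (Torus.timeDerivWithin (Icc 0 1) a κ y.1 / a κ y.1
        - 3 / 2 * (Torus.timeDerivWithin (Icc 0 1) θ₀ κ y.1 / θ₀ κ y.1)
        + ⟪y.2 - u₀ κ y.1, Torus.timeDerivWithin (Icc 0 1) u₀ κ y.1⟫_ℝ / θ₀ κ y.1
        + Torus.timeDerivWithin (Icc 0 1) θ₀ κ y.1 * ‖y.2 - u₀ κ y.1‖ ^ 2 / (2 * θ₀ κ y.1 ^ 2))
      (Icc 0 1) κ := by
  obtain ⟨x, v⟩ := y
  set da := Torus.timeDerivWithin (Icc 0 1) a κ x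
  set dθ := Torus.timeDerivWithin (Icc 0 1) θ₀ κ x
  set du := Torus.timeDerivWithin (Icc 0 1) u₀ κ x
  have haκ : 0 < a κ x := ha0 κ hκ x
  have hθκ : 0 < θ₀ κ x := hθ0 κ hκ x
  have hA : HasDerivWithinAt (fun κ' => a κ' x) da (Icc 0 1) κ := ha.hasDerivWithinAt_slice hκ x
  have hT : HasDerivWithinAt (fun κ' => θ₀ κ' x) dθ (Icc 0 1) κ := hθ.hasDerivWithinAt_slice hκ x
  have hU : HasDerivWithinAt (fun κ' => u₀ κ' x) du (Icc 0 1) κ := hu.hasDerivWithinAt_slice hκ x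
  -- the three terms
  have h1 : HasDerivWithinAt (fun κ' => Real.log (a κ' x)) (da / a κ x) (Icc 0 1) κ := hA.log haκ.ne'
  have h2 : HasDerivWithinAt (fun κ' => Real.log (2 * π * θ₀ κ' x))
      (2 * π * dθ / (2 * π * θ₀ κ x)) (Icc 0 1) κ :=
    (hT.const_mul (2 * π)).log (by positivity)
  have h3 : HasDerivWithinAt (fun κ' => v - u₀ κ' x) (-du) (Icc 0 1) κ := hU.const_sub v
  have h4 : HasDerivWithinAt (fun κ' => ⟪v - u₀ κ' x, v - u₀ κ' x⟫_ℝ)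
      (⟪v - u₀ κ x, -du⟫_ℝ + ⟪-du, v - u₀ κ x⟫_ℝ) (Icc 0 1) κ := h3.inner ℝ h3
  have h5 : HasDerivWithinAt (fun κ' => 2 * θ₀ κ' x) (2 * dθ) (Icc 0 1) κ := hT.const_mul 2
  have h6 : HasDerivWithinAt (fun κ' => ⟪v - u₀ κ' x, v - u₀ κ' x⟫_ℝ / (2 * θ₀ κ' x))
      (((⟪v - u₀ κ x, -du⟫_ℝ + ⟪-du, v - u₀ κ x⟫_ℝ) * (2 * θ₀ κ x)
        - ⟪v - u₀ κ x, v - u₀ κ x⟫_ℝ * (2 * dθ)) / (2 * θ₀ κ x) ^ 2) (Icc 0 1) κ :=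
    h4.div h5 (by positivity)
  have hsum := (h1.sub (h2.const_mul (3 / 2))).sub h6
  -- identify the function on `[0,1]` and the derivative
  have hfun : ∀ κ' ∈ Icc (0 : ℝ) 1, Real.log (localGibbsProfile (a κ') (u₀ κ') (θ₀ κ') (x, v)) =
      Real.log (a κ' x) - 3 / 2 * Real.log (2 * π * θ₀ κ' x)
        - ⟪v - u₀ κ' x, v - u₀ κ' x⟫_ℝ / (2 * θ₀ κ' x) := by
    intro κ' hκ'
    rw [log_localGibbsProfile (u₀ κ') (ha0 κ' hκ' x) (hθ0 κ' hκ' x), real_inner_self_eq_norm_sq]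
  refine (hsum.congr (fun κ' hκ' => hfun κ' hκ') (hfun κ hκ)).congr_deriv ?_
  simp only [inner_neg_right, inner_neg_left, real_inner_self_eq_norm_sq]
  rw [real_inner_comm (v - u₀ κ x) du]
  have h2π : (2 : ℝ) * π ≠ 0 := by positivity
  field_simp
  ring

include ha hθ hu ha0 hθ0 in
/-- The score in closed form: the value of
`derivWithin (κ ↦ log f_κ(x,v)) [0,1] κ`. [folklore] -/
theorem derivWithin_log_localGibbsProfile {κ : ℝ} (hκ : κ ∈ Icc (0 : ℝ) 1) (y : T3 × V3) :
    derivWithin (fun κ' => Real.log (localGibbsProfile (a κ') (u₀ κ') (θ₀ κ') y)) (Icc 0 1) κ =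
      Torus.timeDerivWithin (Icc 0 1) a κ y.1 / a κ y.1
        - 3 / 2 * (Torus.timeDerivWithin (Icc 0 1) θ₀ κ y.1 / θ₀ κ y.1)
        + ⟪y.2 - u₀ κ y.1, Torus.timeDerivWithin (Icc 0 1) u₀ κ y.1⟫_ℝ / θ₀ κ y.1
        + Torus.timeDerivWithin (Icc 0 1) θ₀ κ y.1 * ‖y.2 - u₀ κ y.1‖ ^ 2 / (2 * θ₀ κ y.1 ^ 2) :=
  (hasDerivWithinAt_log_localGibbsProfile ha hθ hu ha0 hθ0 hκ y).derivWithin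
    (uniqueDiffOn_Icc zero_lt_one κ hκ)

include ha hθ hu ha0 hθ0 in
/-- **The profile differentiates to itself times the score**: within `[0,1]`,
`∂_κ f_κ(x,v) = f_κ(x,v) s_κ(x,v)`. [folklore] -/
theorem hasDerivWithinAt_localGibbsProfile {κ : ℝ} (hκ : κ ∈ Icc (0 : ℝ) 1) (y : T3 × V3) :
    HasDerivWithinAt (fun κ' => localGibbsProfile (a κ') (u₀ κ') (θ₀ κ') y)
      (localGibbsProfile (a κ) (u₀ κ) (θ₀ κ) y *
        derivWithin (fun κ' => Real.log (localGibbsProfile (a κ') (u₀ κ') (θ₀ κ') y)) (Icc 0 1) κ)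
      (Icc 0 1) κ := by
  have hlog := hasDerivWithinAt_log_localGibbsProfile ha hθ hu ha0 hθ0 hκ y
  have hpos : ∀ κ' ∈ Icc (0 : ℝ) 1, 0 < localGibbsProfile (a κ') (u₀ κ') (θ₀ κ') y :=
    fun κ' hκ' => localGibbsProfile_pos' (u₀ κ') (ha0 κ' hκ' y.1) (hθ0 κ' hκ' y.1)
  rw [derivWithin_log_localGibbsProfile ha hθ hu ha0 hθ0 hκ y]
  refine (hlog.exp.congr (fun κ' hκ' => ?_) ?_).congr_deriv ?_
  · exact (Real.exp_log (hpos κ' hκ')).symm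
  · exact (Real.exp_log (hpos κ hκ)).symm
  · rw [Real.exp_log (hpos κ hκ)]

include ha hθ hu ha0 hθ0 in
/-- The profile is continuous in `κ ∈ [0,1]` for every `(x, v)`. [folklore] -/
theorem continuousOn_localGibbsProfile (y : T3 × V3) :
    ContinuousOn (fun κ' => localGibbsProfile (a κ') (u₀ κ') (θ₀ κ') y) (Icc 0 1) :=
  fun _ hκ => (hasDerivWithinAt_localGibbsProfile ha hθ hu ha0 hθ0 hκ y).continuousWithinAt

include ha hθ hu hθ0 in
/-- The profile `f_κ` is continuous in `(x, v)` for every `κ ∈ [0,1]`. [folklore] -/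
theorem continuous_localGibbsProfile {κ : ℝ} (hκ : κ ∈ Icc (0 : ℝ) 1) :
    Continuous fun y : T3 × V3 => localGibbsProfile (a κ) (u₀ κ) (θ₀ κ) y := by
  have hac : Continuous (a κ) := (ha.isSmooth_slice hκ).continuous
  have hθc : Continuous (θ₀ κ) := (hθ.isSmooth_slice hκ).continuous
  have huc : Continuous (u₀ κ) := (hu.isSmooth_slice hκ).continuous
  have hform : (fun y : T3 × V3 => localGibbsProfile (a κ) (u₀ κ) (θ₀ κ) y) = fun y =>
      a κ y.1 * ((2 * π * θ₀ κ y.1) ^ (-(3 : ℝ) / 2) *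
        Real.exp (-‖y.2 - u₀ κ y.1‖ ^ 2 / (2 * θ₀ κ y.1))) :=
    funext fun y => localGibbsProfile_eq _ _ _ y
  rw [hform]
  refine (hac.comp continuous_fst).mul ((Continuous.rpow_const ?_ fun y => ?_).mul ?_)
  · exact (continuous_const.mul (hθc.comp continuous_fst))
  · exact Or.inl (by have := hθ0 κ hκ y.1; positivity)
  · refine Real.continuous_exp.comp (Continuous.div ?_ ?_ fun y => ?_)
    · exact ((continuous_snd.sub (huc.comp continuous_fst)).norm.pow 2).neg
    · exact continuous_const.mul (hθc.comp continuous_fst)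
    · have := hθ0 κ hκ y.1; positivity

include ha hθ hu ha0 hθ0 in
/-- The score `s_κ` is continuous in `(x, v)` for every `κ ∈ [0,1]` (its closed form is built
from smooth slices). [folklore] -/
theorem continuous_score {κ : ℝ} (hκ : κ ∈ Icc (0 : ℝ) 1) :
    Continuous fun y : T3 × V3 =>
      Torus.timeDerivWithin (Icc 0 1) a κ y.1 / a κ y.1
        - 3 / 2 * (Torus.timeDerivWithin (Icc 0 1) θ₀ κ y.1 / θ₀ κ y.1)
        + ⟪y.2 - u₀ κ y.1, Torus.timeDerivWithin (Icc 0 1) u₀ κ y.1⟫_ℝ / θ₀ κ y.1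
        + Torus.timeDerivWithin (Icc 0 1) θ₀ κ y.1 * ‖y.2 - u₀ κ y.1‖ ^ 2 / (2 * θ₀ κ y.1 ^ 2) := by
  have hI : UniqueDiffOn ℝ (Icc (0 : ℝ) 1) := uniqueDiffOn_Icc zero_lt_one
  have hac : Continuous (a κ) := (ha.isSmooth_slice hκ).continuous
  have hθc : Continuous (θ₀ κ) := (hθ.isSmooth_slice hκ).continuous
  have huc : Continuous (u₀ κ) := (hu.isSmooth_slice hκ).continuous
  have hdac : Continuous (Torus.timeDerivWithin (Icc 0 1) a κ) :=
    (ha.isSmooth_timeDerivWithin hI hκ).continuous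
  have hdθc : Continuous (Torus.timeDerivWithin (Icc 0 1) θ₀ κ) :=
    (hθ.isSmooth_timeDerivWithin hI hκ).continuous
  have hduc : Continuous (Torus.timeDerivWithin (Icc 0 1) u₀ κ) :=
    (hu.isSmooth_timeDerivWithin hI hκ).continuous
  have hθne : ∀ y : T3 × V3, θ₀ κ y.1 ≠ 0 := fun y => (hθ0 κ hκ y.1).ne'
  have hane : ∀ y : T3 × V3, a κ y.1 ≠ 0 := fun y => (ha0 κ hκ y.1).ne'
  refine ((((hdac.comp continuous_fst).div (hac.comp continuous_fst) hane).sub ?_).add ?_).add ?_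
  · exact continuous_const.mul ((hdθc.comp continuous_fst).div (hθc.comp continuous_fst) hθne)
  · exact ((continuous_snd.sub (huc.comp continuous_fst)).inner (hduc.comp continuous_fst)).div
      (hθc.comp continuous_fst) hθne
  · exact ((hdθc.comp continuous_fst).mul ((continuous_snd.sub (huc.comp continuous_fst)).norm.pow 2)).div
      (continuous_const.mul ((hθc.comp continuous_fst).pow 2)) fun y => by
        have := hθ0 κ hκ y.1; positivity

/-! ## Uniform bounds: the score grows quadratically, the profile decays like a Gaussian -/

/-- Elementary: `‖v - u‖ ≤ 1 + ‖v‖² + U` for `‖u‖ ≤ U`. [folklore] -/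
theorem norm_sub_le_one_add_sq_add {v u : V3} {U : ℝ} (hU : ‖u‖ ≤ U) :
    ‖v - u‖ ≤ 1 + ‖v‖ ^ 2 + U := by
  have h1 : ‖v - u‖ ≤ ‖v‖ + ‖u‖ := norm_sub_le _ _
  nlinarith [sq_nonneg (‖v‖ - 1), norm_nonneg v]

/-- Elementary: `‖v - u‖² ≤ 2‖v‖² + 2U²` for `‖u‖ ≤ U`. [folklore] -/
theorem norm_sub_sq_le {v u : V3} {U : ℝ} (hU : ‖u‖ ≤ U) :
    ‖v - u‖ ^ 2 ≤ 2 * ‖v‖ ^ 2 + 2 * U ^ 2 := by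
  have h1 : ‖v - u‖ ≤ ‖v‖ + ‖u‖ := norm_sub_le _ _
  have h2 : ‖v - u‖ ^ 2 ≤ (‖v‖ + ‖u‖) ^ 2 := pow_le_pow_left₀ (norm_nonneg _) h1 2
  have h3 : ‖u‖ ^ 2 ≤ U ^ 2 := pow_le_pow_left₀ (norm_nonneg _) hU 2
  nlinarith [sq_nonneg (‖v‖ - ‖u‖)]

/-- Elementary: `‖v‖² ≤ 2‖v - u‖² + 2U²` for `‖u‖ ≤ U`. [folklore] -/
theorem norm_sq_le_two_mul_norm_sub_sq {v u : V3} {U : ℝ} (hU : ‖u‖ ≤ U) :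
    ‖v‖ ^ 2 ≤ 2 * ‖v - u‖ ^ 2 + 2 * U ^ 2 := by
  have h1 : ‖v‖ ≤ ‖v - u‖ + ‖u‖ := by
    calc ‖v‖ = ‖(v - u) + u‖ := by rw [sub_add_cancel]
      _ ≤ ‖v - u‖ + ‖u‖ := norm_add_le _ _
  have h2 : ‖v‖ ^ 2 ≤ (‖v - u‖ + ‖u‖) ^ 2 := pow_le_pow_left₀ (norm_nonneg _) h1 2
  have h3 : ‖u‖ ^ 2 ≤ U ^ 2 := pow_le_pow_left₀ (norm_nonneg _) hU 2
  nlinarith [sq_nonneg (‖v - u‖ - ‖u‖)]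

include ha hθ hu ha0 hθ0 in
/-- **Quadratic growth of the score**: there is `A` with `|s_κ(x,v)| ≤ A (1 + |v|²)` for all
`κ ∈ [0,1]`, `x ∈ 𝕋³`, `v ∈ ℝ³` (compactness bounds on `a, θ₀, u₀` and their `κ`-derivatives,
`a ≥ a_min > 0`, `θ₀ ≥ θ_min > 0`). [folklore] -/
theorem exists_abs_score_le :
    ∃ A : ℝ, 0 ≤ A ∧ ∀ κ ∈ Icc (0 : ℝ) 1, ∀ y : T3 × V3,
      |derivWithin (fun κ' => Real.log (localGibbsProfile (a κ') (u₀ κ') (θ₀ κ') y)) (Icc 0 1) κ| ≤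
        A * (1 + ‖y.2‖ ^ 2) := by
  obtain ⟨amin, hamin, hamin_le⟩ := exists_pos_le_of_isSmoothSpaceTimeOn ha ha0
  obtain ⟨θmin, hθmin, hθmin_le⟩ := exists_pos_le_of_isSmoothSpaceTimeOn hθ hθ0
  obtain ⟨U, hU0, hU⟩ := exists_norm_le_of_isSmoothSpaceTimeOn hu
  obtain ⟨Da, hDa0, hDa⟩ := exists_norm_timeDerivWithin_le ha
  obtain ⟨Dθ, hDθ0, hDθ⟩ := exists_norm_timeDerivWithin_le hθ
  obtain ⟨Du, hDu0, hDu⟩ := exists_norm_timeDerivWithin_le hu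
  refine ⟨Da / amin + 3 / 2 * (Dθ / θmin) + Du / θmin * (1 + U) + Dθ / (2 * θmin ^ 2) * (2 + 2 * U ^ 2),
    by positivity, fun κ hκ y => ?_⟩
  rw [derivWithin_log_localGibbsProfile ha hθ hu ha0 hθ0 hκ y]
  obtain ⟨x, v⟩ := y
  simp only
  set da := Torus.timeDerivWithin (Icc 0 1) a κ x
  set dθ := Torus.timeDerivWithin (Icc 0 1) θ₀ κ x
  set du := Torus.timeDerivWithin (Icc 0 1) u₀ κ x
  have haκ : amin ≤ a κ x := hamin_le κ hκ x
  have hθκ : θmin ≤ θ₀ κ x := hθmin_le κ hκ x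
  have hapos : 0 < a κ x := ha0 κ hκ x
  have hθpos : 0 < θ₀ κ x := hθ0 κ hκ x
  have h1 : |da / a κ x| ≤ Da / amin := by
    rw [abs_div, abs_of_pos hapos]
    exact div_le_div₀ hDa0 (by simpa [Real.norm_eq_abs] using hDa κ hκ x) hamin haκ
  have h2 : |3 / 2 * (dθ / θ₀ κ x)| ≤ 3 / 2 * (Dθ / θmin) := by
    rw [abs_mul, abs_of_pos (by norm_num : (0 : ℝ) < 3 / 2), abs_div, abs_of_pos hθpos]
    refine mul_le_mul_of_nonneg_left ?_ (by norm_num)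
    exact div_le_div₀ hDθ0 (by simpa [Real.norm_eq_abs] using hDθ κ hκ x) hθmin hθκ
  have h3 : |⟪v - u₀ κ x, du⟫_ℝ / θ₀ κ x| ≤ Du / θmin * (1 + U) * (1 + ‖v‖ ^ 2) := by
    rw [abs_div, abs_of_pos hθpos]
    have hcs : |⟪v - u₀ κ x, du⟫_ℝ| ≤ ‖v - u₀ κ x‖ * ‖du‖ := abs_real_inner_le_norm _ _
    have hvu : ‖v - u₀ κ x‖ ≤ 1 + ‖v‖ ^ 2 + U := norm_sub_le_one_add_sq_add (hU κ hκ x)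
    have hdu : ‖du‖ ≤ Du := hDu κ hκ x
    have hnum : |⟪v - u₀ κ x, du⟫_ℝ| ≤ (1 + ‖v‖ ^ 2 + U) * Du :=
      hcs.trans (mul_le_mul hvu hdu (norm_nonneg _) (by positivity))
    have hfrac : |⟪v - u₀ κ x, du⟫_ℝ| / θ₀ κ x ≤ (1 + ‖v‖ ^ 2 + U) * Du / θmin :=
      div_le_div₀ (by positivity) hnum hθmin hθκ
    refine hfrac.trans ?_
    rw [div_mul_eq_mul_div, div_mul_eq_mul_div, div_le_div_iff_of_pos_right hθmin]
    nlinarith [sq_nonneg ‖v‖, mul_nonneg hDu0 hU0, mul_nonneg (mul_nonneg hDu0 hU0) (sq_nonneg ‖v‖)]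
  have h4 : |dθ * ‖v - u₀ κ x‖ ^ 2 / (2 * θ₀ κ x ^ 2)| ≤
      Dθ / (2 * θmin ^ 2) * (2 + 2 * U ^ 2) * (1 + ‖v‖ ^ 2) := by
    rw [abs_div, abs_mul, abs_of_nonneg (sq_nonneg ‖v - u₀ κ x‖),
      abs_of_pos (by positivity : (0 : ℝ) < 2 * θ₀ κ x ^ 2)]
    have hvu : ‖v - u₀ κ x‖ ^ 2 ≤ 2 * ‖v‖ ^ 2 + 2 * U ^ 2 := norm_sub_sq_le (hU κ hκ x)
    have hdθ : |dθ| ≤ Dθ := by simpa [Real.norm_eq_abs] using hDθ κ hκ x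
    have hnum : |dθ| * ‖v - u₀ κ x‖ ^ 2 ≤ Dθ * (2 * ‖v‖ ^ 2 + 2 * U ^ 2) :=
      mul_le_mul hdθ hvu (sq_nonneg _) hDθ0
    have hden : 2 * θmin ^ 2 ≤ 2 * θ₀ κ x ^ 2 := by
      nlinarith [mul_le_mul hθκ hθκ hθmin.le hθpos.le]
    have hfrac : |dθ| * ‖v - u₀ κ x‖ ^ 2 / (2 * θ₀ κ x ^ 2) ≤ Dθ * (2 * ‖v‖ ^ 2 + 2 * U ^ 2) / (2 * θmin ^ 2) :=
      div_le_div₀ (by positivity) hnum (by positivity) hden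
    refine hfrac.trans ?_
    rw [div_mul_eq_mul_div, div_mul_eq_mul_div, div_le_div_iff_of_pos_right (by positivity)]
    nlinarith [sq_nonneg ‖v‖, sq_nonneg U, mul_nonneg hDθ0 (sq_nonneg U),
      mul_nonneg (mul_nonneg hDθ0 (sq_nonneg U)) (sq_nonneg ‖v‖), mul_nonneg hDθ0 (sq_nonneg ‖v‖)]
  calc |da / a κ x - 3 / 2 * (dθ / θ₀ κ x) + ⟪v - u₀ κ x, du⟫_ℝ / θ₀ κ x +
          dθ * ‖v - u₀ κ x‖ ^ 2 / (2 * θ₀ κ x ^ 2)|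
      ≤ |da / a κ x| + |3 / 2 * (dθ / θ₀ κ x)| + |⟪v - u₀ κ x, du⟫_ℝ / θ₀ κ x| +
          |dθ * ‖v - u₀ κ x‖ ^ 2 / (2 * θ₀ κ x ^ 2)| := by
        have e1 := abs_add_le (da / a κ x - 3 / 2 * (dθ / θ₀ κ x) + ⟪v - u₀ κ x, du⟫_ℝ / θ₀ κ x)
          (dθ * ‖v - u₀ κ x‖ ^ 2 / (2 * θ₀ κ x ^ 2))
        have e2 := abs_add_le (da / a κ x - 3 / 2 * (dθ / θ₀ κ x)) (⟪v - u₀ κ x, du⟫_ℝ / θ₀ κ x)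
        have e3 := abs_sub (da / a κ x) (3 / 2 * (dθ / θ₀ κ x))
        linarith
    _ ≤ Da / amin + 3 / 2 * (Dθ / θmin) + Du / θmin * (1 + U) * (1 + ‖v‖ ^ 2) +
          Dθ / (2 * θmin ^ 2) * (2 + 2 * U ^ 2) * (1 + ‖v‖ ^ 2) := by
        linarith
    _ ≤ (Da / amin + 3 / 2 * (Dθ / θmin) + Du / θmin * (1 + U) + Dθ / (2 * θmin ^ 2) * (2 + 2 * U ^ 2)) *
          (1 + ‖v‖ ^ 2) := by
        have hc1 : 0 ≤ Da / amin := by positivity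
        have hc2 : 0 ≤ 3 / 2 * (Dθ / θmin) := by positivity
        nlinarith

include ha hθ hu ha0 hθ0 in
/-- **Gaussian decay of the profile, uniformly along the path**: there are `B ≥ 0` and `c > 0`
with `0 < f_κ(x,v) ≤ B exp(-c |v|²)` for all `κ ∈ [0,1]`, `x`, `v`
(`a ≤ A`, `θ_min ≤ θ₀ ≤ Θ`, `|u₀| ≤ U`; `|v - u|² ≥ |v|²/2 - U²`). [folklore] -/
theorem exists_localGibbsProfile_le_exp :
    ∃ B c : ℝ, 0 ≤ B ∧ 0 < c ∧ ∀ κ ∈ Icc (0 : ℝ) 1, ∀ y : T3 × V3,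
      localGibbsProfile (a κ) (u₀ κ) (θ₀ κ) y ≤ B * Real.exp (-c * ‖y.2‖ ^ 2) := by
  obtain ⟨θmin, hθmin, hθmin_le⟩ := exists_pos_le_of_isSmoothSpaceTimeOn hθ hθ0
  obtain ⟨U, hU0, hU⟩ := exists_norm_le_of_isSmoothSpaceTimeOn hu
  obtain ⟨Amax, hA0, hA⟩ := exists_norm_le_of_isSmoothSpaceTimeOn ha
  obtain ⟨Θ, hΘ0, hΘ⟩ := exists_norm_le_of_isSmoothSpaceTimeOn hθ
  have hΘpos : 0 < Θ := by
    have h := hΘ 0 ⟨le_rfl, zero_le_one⟩ 0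
    rw [Real.norm_eq_abs] at h
    exact lt_of_lt_of_le (hθ0 0 ⟨le_rfl, zero_le_one⟩ 0) ((le_abs_self _).trans h)
  refine ⟨Amax * ((2 * π * θmin) ^ (-(3 : ℝ) / 2) * Real.exp (U ^ 2 / (2 * θmin))), 1 / (4 * Θ),
    by positivity, by positivity, fun κ hκ y => ?_⟩
  obtain ⟨x, v⟩ := y
  rw [localGibbsProfile_eq]
  simp only
  have hapos : 0 < a κ x := ha0 κ hκ x
  have hθpos : 0 < θ₀ κ x := hθ0 κ hκ x
  have haA : a κ x ≤ Amax := by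
    have h := hA κ hκ x
    rw [Real.norm_eq_abs, abs_of_pos hapos] at h
    exact h
  have hθΘ : θ₀ κ x ≤ Θ := by
    have h := hΘ κ hκ x
    rw [Real.norm_eq_abs, abs_of_pos hθpos] at h
    exact h
  have hθκ : θmin ≤ θ₀ κ x := hθmin_le κ hκ x
  -- the prefactor
  have hpow : (2 * π * θ₀ κ x) ^ (-(3 : ℝ) / 2) ≤ (2 * π * θmin) ^ (-(3 : ℝ) / 2) :=
    Real.rpow_le_rpow_of_nonpos (by positivity) (by nlinarith [Real.pi_pos]) (by norm_num)
  -- the exponent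
  have hvu : ‖v‖ ^ 2 ≤ 2 * ‖v - u₀ κ x‖ ^ 2 + 2 * U ^ 2 := norm_sq_le_two_mul_norm_sub_sq (hU κ hκ x)
  have hexp : -‖v - u₀ κ x‖ ^ 2 / (2 * θ₀ κ x) ≤ U ^ 2 / (2 * θmin) + -(1 / (4 * Θ)) * ‖v‖ ^ 2 := by
    have hA1 : -‖v - u₀ κ x‖ ^ 2 / (2 * θ₀ κ x) ≤ (U ^ 2 - ‖v‖ ^ 2 / 2) / (2 * θ₀ κ x) :=
      div_le_div_of_nonneg_right (by linarith) (by positivity)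
    have hA2 : (U ^ 2 - ‖v‖ ^ 2 / 2) / (2 * θ₀ κ x) = U ^ 2 / (2 * θ₀ κ x) - ‖v‖ ^ 2 / (4 * θ₀ κ x) := by
      field_simp
      ring
    have hA3 : U ^ 2 / (2 * θ₀ κ x) ≤ U ^ 2 / (2 * θmin) :=
      div_le_div_of_nonneg_left (sq_nonneg _) (by positivity) (by linarith)
    have hA4 : ‖v‖ ^ 2 / (4 * Θ) ≤ ‖v‖ ^ 2 / (4 * θ₀ κ x) :=
      div_le_div_of_nonneg_left (sq_nonneg _) (by positivity) (by linarith)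
    rw [show -(1 / (4 * Θ)) * ‖v‖ ^ 2 = -(‖v‖ ^ 2 / (4 * Θ)) by ring]
    linarith
  calc a κ x * ((2 * π * θ₀ κ x) ^ (-(3 : ℝ) / 2) * Real.exp (-‖v - u₀ κ x‖ ^ 2 / (2 * θ₀ κ x)))
      ≤ Amax * ((2 * π * θmin) ^ (-(3 : ℝ) / 2) * Real.exp (U ^ 2 / (2 * θmin) + -(1 / (4 * Θ)) * ‖v‖ ^ 2)) := by
        refine mul_le_mul haA (mul_le_mul hpow (Real.exp_le_exp.2 hexp) (Real.exp_nonneg _)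
          (Real.rpow_nonneg (by positivity) _)) (by positivity) hA0
    _ = Amax * ((2 * π * θmin) ^ (-(3 : ℝ) / 2) * Real.exp (U ^ 2 / (2 * θmin))) *
          Real.exp (-(1 / (4 * Θ)) * ‖v‖ ^ 2) := by
        rw [Real.exp_add]
        ring

end Path

end Summit.AtomisticToContinuum.HydrodynamicLimit.Theorems.OneSphereInfluenceAssembly

end
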